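import Summits.ABC.StewartYu.PadicG3SatData
import Summits.ABC.StewartYu.PadicG3StepPacks
import Summits.ABC.StewartYu.PadicG3Start
import HarnessLib

/-!
# Cell abc-stewartyu, WP-L.P(odd) (crux r3 `PadicCoreOddRat`, stmt-ABC-20503): the LEVEL INVARIANT OF THE SATURATED FRAME with TWO interval
# boxes (θ-coordinates and VIRTUAL coordinates), the k-steps on it, the k-step record packages and the k-chain

`Summits/ABC/StewartYu/PadicG3SatLevels.lean` — cell `abc-stewartyu` (HOME `run/shared/lean/pub/abc-stewartyu/`, design memo
HOME/p2/memo-07-WPLP-odd-Nframe-design.md §2 rows «k-step Liouville» / «level invariant»; seat p2-g6).  Definitions (`LvInvSatI`, `KStepHypSatU`,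
`KStepOddHypSatU` — `Prop`-valued) and theorems on `G3Setup`; no named fact, no parameters.

`LvInvSatI F R B v sgn pv lo L vlo Bv P m Xs T` — the landed interval-box invariant `LvInvI R B v sgn pv lo L P m Xs T` (θ-coordinate box
`loⱼ ≤ vᵢⱼ ≤ loⱼ + Lⱼ`, used ONLY for the directional ceilings `𝔛` and the naturality of the half-point root exponents) TOGETHER WITH the
VIRTUAL interval box `vloⱼ ≤ ν(vᵢ)ⱼ ≤ vloⱼ + Bvⱼ` (`ν(μ) = μ ᵥ* F.U`, `F : S.SatData`), which carries every SIZE (heights / denominators of the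
monomials `θ^{vᵢ x}` through `F.Dm`, `F.Dh`).  Both boxes halve under the Kummer half-step (`PadicG3SatLevelStepH`).

* `LvInvSatI.kstep` / `kstep_odd` — the two k-steps (symmetric nodes / odd nodes) with the monomial datum `Dm = monDen αo (E Bv x)`, `Mm = Dm²`
  supplied from the virtual box (`PadicG3SatKStep.g3_kstep_pm_gen` on the UNMODIFIED `norm_g3F_le_of_zerosΦ`);
* `KStepHypSatU` / `KStepOddHypSatU` — the record packages (the landed `KStepHypU` with `(monDen S.α (boxExpG L x))²` replaced by `(F.Dm Bv x)²`);
  `kstep_of_hypU`, `kstep_odd_of_hypU`, `kchain`.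

WHAT THIS IS NOT: the half-step (`PadicG3SatLevelStepH`), the START, the output; no crux moves.

References: Yu. V. Nesterenko, LNM 1819 (2003) Prop. 4.1, §4.2, Lemma 3.11; K. Yu, Acta Math. 211 (2013) §5, Lemma 5.2.
-/

noncomputable section

open NormedSpace Finset Polynomial
open scoped Matrix
open Literature.NumberTheory.Transcendental
open Literature.NumberTheory.Transcendental.PadicCW77 (condExp)
open Literature.NumberTheory.Transcendental.CW77.Setup (Tau tauNorm)
open scoped Nat

namespace Summit.ABC.StewartYu

namespace G3Setup

variable {p : ℕ} [Fact p.Prime] (S : G3Setup p) {ι : Type*}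

/-- **The level invariant of the saturated frame**: the landed `LvInvI` (θ-coordinate interval box) plus the VIRTUAL interval box
`vloⱼ ≤ ν(vᵢ)ⱼ ≤ vloⱼ + Bvⱼ` containing `0`. [cite: Nesterenko2003, Prop 4.1 with §3.5 (𝔏 ⊂ 𝔑); shape only] -/
structure LvInvSatI (F : S.SatData) (R : ι → ℚ[X]) (B : Finset ι) (v : ι → Fin S.n → ℤ) (sgn pv : ι → ℤ) (lo : Fin S.n → ℤ)
    (L : Fin S.n → ℕ) (vlo : Fin S.n → ℤ) (Bv : Fin S.n → ℕ) (P : ℤ) (m : ℕ) (Xs : Set ℤ) (T : ℕ) : Prop where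
  /-- the landed invariant with the θ-coordinate interval box -/
  toI : S.LvInvI R B v sgn pv lo L P m Xs T
  /-- the virtual interval box contains `0` -/
  vlo_le : ∀ j, vlo j ≤ 0 ∧ 0 ≤ vlo j + Bv j
  /-- the virtual exponents lie in the virtual interval box -/
  vbox : ∀ i ∈ B, ∀ j, vlo j ≤ (v i ᵥ* F.U) j ∧ (v i ᵥ* F.U) j ≤ vlo j + Bv j

namespace LvInvSatI

variable {S} {F : S.SatData} {R R' : ι → ℚ[X]} {B : Finset ι} {v : ι → Fin S.n → ℤ} {sgn pv : ι → ℤ} {lo : Fin S.n → ℤ}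
  {L : Fin S.n → ℕ} {vlo : Fin S.n → ℤ} {Bv : Fin S.n → ℕ} {P : ℤ} {m : ℕ} {Xs : Set ℤ} {T : ℕ}

/-- Changing the node set and the order by an implication. [folklore] -/
theorem mono (h : S.LvInvSatI F R B v sgn pv lo L vlo Bv P m Xs T) {Xs' : Set ℤ} {T' : ℕ} (hX : Xs' ⊆ Xs) (hT : T' ≤ T) :
    S.LvInvSatI F R B v sgn pv lo L vlo Bv P m Xs' T' :=
  ⟨h.toI.mono hX hT, h.vlo_le, h.vbox⟩

/-- The absolute virtual box: `|ν(vᵢ)ⱼ| ≤ Bvⱼ`. [folklore] -/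
theorem vabs_le (h : S.LvInvSatI F R B v sgn pv lo L vlo Bv P m Xs T) : ∀ i ∈ B, ∀ j, |(v i ᵥ* F.U) j| ≤ (Bv j : ℤ) := by
  intro i hi j
  have h1 := h.vbox i hi j
  have h2 := h.vlo_le j
  rw [_root_.abs_le]; constructor <;> omega

/-- Differences of virtual exponents are bounded by `Bvⱼ`. [folklore] -/
theorem vabs_sub_le (h : S.LvInvSatI F R B v sgn pv lo L vlo Bv P m Xs T) :
    ∀ i ∈ B, ∀ i' ∈ B, ∀ j, |(v i ᵥ* F.U) j - (v i' ᵥ* F.U) j| ≤ (Bv j : ℤ) := by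
  intro i hi i' hi' j
  have h1 := h.vbox i hi j
  have h2 := h.vbox i' hi' j
  rw [_root_.abs_le]; constructor <;> omega

/-- The invariant only sees the `Y₀`-polynomials through their Hasse values at integer points. [folklore] -/
theorem congr_R (h : S.LvInvSatI F R B v sgn pv lo L vlo Bv P m Xs T)
    (hRR' : ∀ i ∈ B, ∀ (t : ℕ) (x : ℤ), (hasseDeriv t (R i)).eval (x : ℚ) = (hasseDeriv t (R' i)).eval (x : ℚ)) :
    S.LvInvSatI F R' B v sgn pv lo L vlo Bv P m Xs T :=
  ⟨h.toI.congr_R hRR', h.vlo_le, h.vbox⟩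

/-- **The k-step on the saturated invariant** (symmetric nodes `|x| ≤ N` → `|x| ≤ N′`, orders `T → T′`, `T′ + t ≤ T`): the record's `Y₀`-weight
bound `Bw`, pointwise Liouville datum `(den₀, M₀, Xb, K)` with the VIRTUAL monomial denominator `F.Dm Bv x` in `K`, and the inequality `hfinal`.
[cite: Nesterenko2003, §4.2] [cite: Yu2013, Lemma 5.2] -/
theorem kstep {N : ℕ} (h : S.LvInvSatI F R B v sgn pv lo L vlo Bv P m {x : ℤ | |x| ≤ (N : ℤ)} T) {N' T' t : ℕ} (ht : 1 ≤ t)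
    (hT : T' + t ≤ T) {Bw : ℝ} (hBw0 : 0 ≤ Bw)
    (hBw : ∀ i ∈ B, ∀ t₀ k, ‖(hw (p := p) R i t₀).coeff k‖ * ((p : ℝ) ^ m * Real.sqrt p) ^ k ≤ Bw)
    (hΛ : ‖S.Λ / (S.b S.j₀ : ℚ_[p])‖ ≤ (p : ℝ)⁻¹)
    (den₀ : ℤ → Tau S.n → ℕ) (hden₀ : ∀ x τ, 1 ≤ den₀ x τ) (M₀ : ℤ → Tau S.n → ℤ)
    (hR : ∀ (x : ℤ) (τ : Tau S.n), ∀ i ∈ B, ∃ z₀ : ℤ, (den₀ x τ : ℚ) * (hasseDeriv τ.1 (R i)).eval (x : ℚ) = z₀ ∧ |z₀| ≤ M₀ x τ)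
    {Xb : ℤ} (hX : ∀ i ∈ B, ∀ k, |S.𝔛 (v i) k| ≤ Xb)
    (K : ℤ → Tau S.n → ℝ) (hK0 : ∀ x τ, 0 < K x τ)
    (hK : ∀ (x : ℤ) (τ : Tau S.n), (B.card : ℝ) * P * (M₀ x τ * (Xb : ℝ) ^ (∑ k, τ.2 k) * ((F.Dm Bv x : ℝ)) ^ 2) ≤ K x τ)
    (hfinal : ∀ x₁ : ℤ, |x₁| ≤ (N' : ℤ) → ∀ τ : Tau S.n, tauNorm τ + t ≤ T →
      max (Bw * ‖S.Λ / (S.b S.j₀ : ℚ_[p])‖ * (p : ℝ) ^ ((t - 1) / 2) * (p : ℝ) ^ condExp p (2 * N + 1) t)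
        (Bw / ((p : ℝ) ^ m * Real.sqrt p) ^ ((2 * N + 1) * t)) < 1 / K x₁ τ) :
    S.LvInvSatI F R B v sgn pv lo L vlo Bv P m {x : ℤ | |x| ≤ (N' : ℤ)} T' := by
  have hI := h.toI
  refine ⟨⟨hI.nonzero, hI.bound, hI.lo_le, hI.box, hI.sgn_pm, hI.cls, hI.depth, hI.slab, fun x₁ hx₁ τ hτ => ?_⟩, h.vlo_le, h.vbox⟩
  have hk := S.g3_kstep_pm_gen R v m B hI.depth sgn hI.sgn_pm hI.cls pv ht hBw0 hBw hΛ
    (fun x hx τ'' hτ'' => hI.vanish x hx τ'' hτ'') den₀ hden₀ M₀ hR hX hI.bound (F.Dm Bv) (F.one_le_Dm Bv)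
    (fun x => ((F.Dm Bv x : ℤ)) ^ 2) (F.monomialDatum_of_vbox h.vabs_le) K hK0 (fun x τ => ?_) hfinal
  · exact hk x₁ hx₁ τ (by omega)
  · have := hK x τ
    push_cast at this ⊢
    exact this

/-- **The first k-step of a level on the saturated invariant** (odd nodes `|x| ≤ 2N − 1` → all `|x| ≤ N′`).
[cite: Nesterenko2003, §4.2 with 𝒳_{s,0}] -/
theorem kstep_odd {N : ℕ} (h : S.LvInvSatI F R B v sgn pv lo L vlo Bv P m {x : ℤ | Odd x ∧ |x| ≤ (2 * N - 1 : ℤ)} T) {N' T' t : ℕ}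
    (ht : 1 ≤ t) (hT : T' + t ≤ T) {Bw : ℝ} (hBw0 : 0 ≤ Bw)
    (hBw : ∀ i ∈ B, ∀ t₀ k, ‖(hw (p := p) R i t₀).coeff k‖ * ((p : ℝ) ^ m * Real.sqrt p) ^ k ≤ Bw)
    (hΛ : ‖S.Λ / (S.b S.j₀ : ℚ_[p])‖ ≤ (p : ℝ)⁻¹)
    (den₀ : ℤ → Tau S.n → ℕ) (hden₀ : ∀ x τ, 1 ≤ den₀ x τ) (M₀ : ℤ → Tau S.n → ℤ)
    (hR : ∀ (x : ℤ) (τ : Tau S.n), ∀ i ∈ B, ∃ z₀ : ℤ, (den₀ x τ : ℚ) * (hasseDeriv τ.1 (R i)).eval (x : ℚ) = z₀ ∧ |z₀| ≤ M₀ x τ)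
    {Xb : ℤ} (hX : ∀ i ∈ B, ∀ k, |S.𝔛 (v i) k| ≤ Xb)
    (K : ℤ → Tau S.n → ℝ) (hK0 : ∀ x τ, 0 < K x τ)
    (hK : ∀ (x : ℤ) (τ : Tau S.n), (B.card : ℝ) * P * (M₀ x τ * (Xb : ℝ) ^ (∑ k, τ.2 k) * ((F.Dm Bv x : ℝ)) ^ 2) ≤ K x τ)
    (hfinal : ∀ x₁ : ℤ, |x₁| ≤ (N' : ℤ) → ∀ τ : Tau S.n, tauNorm τ + t ≤ T →
      max (Bw * ‖S.Λ / (S.b S.j₀ : ℚ_[p])‖ * (p : ℝ) ^ ((t - 1) / 2) * (p : ℝ) ^ condExp p (2 * N) t)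
        (Bw / ((p : ℝ) ^ m * Real.sqrt p) ^ ((2 * N) * t)) < 1 / K x₁ τ) :
    S.LvInvSatI F R B v sgn pv lo L vlo Bv P m {x : ℤ | |x| ≤ (N' : ℤ)} T' := by
  have hI := h.toI
  refine ⟨⟨hI.nonzero, hI.bound, hI.lo_le, hI.box, hI.sgn_pm, hI.cls, hI.depth, hI.slab, fun x₁ hx₁ τ hτ => ?_⟩, h.vlo_le, h.vbox⟩
  have hk := S.g3_kstep_pm_oddNodes_gen R v m B hI.depth sgn hI.sgn_pm hI.cls pv ht hBw0 hBw hΛ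
    (fun x hx hx' τ'' hτ'' => hI.vanish x ⟨hx, hx'⟩ τ'' hτ'') den₀ hden₀ M₀ hR hX hI.bound (F.Dm Bv) (F.one_le_Dm Bv)
    (fun x => ((F.Dm Bv x : ℤ)) ^ 2) (F.monomialDatum_of_vbox h.vabs_le) K hK0 (fun x τ => ?_) hfinal
  · exact hk x₁ hx₁ τ (by omega)
  · have := hK x τ
    push_cast at this ⊢
    exact this

end LvInvSatI

/-! ### The k-step record packages of the saturated frame -/

/-- **Record package of one k-step of the saturated frame** (symmetric nodes `N → N′`, orders `T → T′`), uniform over `i ∈ U`, the θ-box `L`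
(directional ceiling `Xb`) and the virtual box `Bv` (monomial denominator `F.Dm Bv x`). [cite: Nesterenko2003, §4.2; shape only] -/
def KStepHypSatU (F : S.SatData) (R : ι → ℚ[X]) (U : Finset ι) (L Bv : Fin S.n → ℕ) (P : ℤ) (m N N' T T' : ℕ) : Prop :=
  ∃ (t : ℕ) (Bw : ℝ) (den₀ : ℤ → Tau S.n → ℕ) (M₀ : ℤ → Tau S.n → ℤ) (Xb : ℤ) (K : ℤ → Tau S.n → ℝ),
    1 ≤ t ∧ T' + t ≤ T ∧ 0 ≤ Bw ∧
    (∀ i ∈ U, ∀ t₀ k, ‖(hw (p := p) R i t₀).coeff k‖ * ((p : ℝ) ^ m * Real.sqrt p) ^ k ≤ Bw) ∧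
    (∀ x τ, 1 ≤ den₀ x τ) ∧
    (∀ (x : ℤ) (τ : Tau S.n), ∀ i ∈ U, ∃ z₀ : ℤ, (den₀ x τ : ℚ) * (hasseDeriv τ.1 (R i)).eval (x : ℚ) = z₀ ∧ |z₀| ≤ M₀ x τ) ∧
    (∀ w : Fin S.n → ℤ, (∀ j, |w j| ≤ (L j : ℤ)) → ∀ k, |S.𝔛 w k| ≤ Xb) ∧
    (∀ x τ, 0 < K x τ) ∧
    (∀ (x : ℤ) (τ : Tau S.n), (U.card : ℝ) * P * (M₀ x τ * (Xb : ℝ) ^ (∑ k, τ.2 k) * ((F.Dm Bv x : ℝ)) ^ 2) ≤ K x τ) ∧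
    (∀ x₁ : ℤ, |x₁| ≤ (N' : ℤ) → ∀ τ : Tau S.n, tauNorm τ + t ≤ T →
      max (Bw * ‖S.Λ / (S.b S.j₀ : ℚ_[p])‖ * (p : ℝ) ^ ((t - 1) / 2) * (p : ℝ) ^ condExp p (2 * N + 1) t)
        (Bw / ((p : ℝ) ^ m * Real.sqrt p) ^ ((2 * N + 1) * t)) < 1 / K x₁ τ)

/-- **Record package of the first k-step of a level of the saturated frame** (odd nodes `|x| ≤ 2N−1 → |x| ≤ N′`).
[cite: Nesterenko2003, §4.2; shape only] -/
def KStepOddHypSatU (F : S.SatData) (R : ι → ℚ[X]) (U : Finset ι) (L Bv : Fin S.n → ℕ) (P : ℤ) (m N N' T T' : ℕ) : Prop :=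
  ∃ (t : ℕ) (Bw : ℝ) (den₀ : ℤ → Tau S.n → ℕ) (M₀ : ℤ → Tau S.n → ℤ) (Xb : ℤ) (K : ℤ → Tau S.n → ℝ),
    1 ≤ t ∧ T' + t ≤ T ∧ 0 ≤ Bw ∧
    (∀ i ∈ U, ∀ t₀ k, ‖(hw (p := p) R i t₀).coeff k‖ * ((p : ℝ) ^ m * Real.sqrt p) ^ k ≤ Bw) ∧
    (∀ x τ, 1 ≤ den₀ x τ) ∧
    (∀ (x : ℤ) (τ : Tau S.n), ∀ i ∈ U, ∃ z₀ : ℤ, (den₀ x τ : ℚ) * (hasseDeriv τ.1 (R i)).eval (x : ℚ) = z₀ ∧ |z₀| ≤ M₀ x τ) ∧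
    (∀ w : Fin S.n → ℤ, (∀ j, |w j| ≤ (L j : ℤ)) → ∀ k, |S.𝔛 w k| ≤ Xb) ∧
    (∀ x τ, 0 < K x τ) ∧
    (∀ (x : ℤ) (τ : Tau S.n), (U.card : ℝ) * P * (M₀ x τ * (Xb : ℝ) ^ (∑ k, τ.2 k) * ((F.Dm Bv x : ℝ)) ^ 2) ≤ K x τ) ∧
    (∀ x₁ : ℤ, |x₁| ≤ (N' : ℤ) → ∀ τ : Tau S.n, tauNorm τ + t ≤ T →
      max (Bw * ‖S.Λ / (S.b S.j₀ : ℚ_[p])‖ * (p : ℝ) ^ ((t - 1) / 2) * (p : ℝ) ^ condExp p (2 * N) t)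
        (Bw / ((p : ℝ) ^ m * Real.sqrt p) ^ ((2 * N) * t)) < 1 / K x₁ τ)

namespace LvInvSatI

variable {S} {F : S.SatData} {R : ι → ℚ[X]} {U B : Finset ι} {v : ι → Fin S.n → ℤ} {sgn pv : ι → ℤ} {lo : Fin S.n → ℤ}
  {L : Fin S.n → ℕ} {vlo : Fin S.n → ℤ} {Bv : Fin S.n → ℕ} {P : ℤ} {m N N' T T' : ℕ}

/-- **k-step from the uniform package.** [cite: Nesterenko2003, §4.2] -/
theorem kstep_of_hypU (hBU : B ⊆ U) (h : S.LvInvSatI F R B v sgn pv lo L vlo Bv P m {x : ℤ | |x| ≤ (N : ℤ)} T)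
    (hΛ : ‖S.Λ / (S.b S.j₀ : ℚ_[p])‖ ≤ (p : ℝ)⁻¹) (H : S.KStepHypSatU F R U L Bv P m N N' T T') :
    S.LvInvSatI F R B v sgn pv lo L vlo Bv P m {x : ℤ | |x| ≤ (N' : ℤ)} T' := by
  obtain ⟨t, Bw, den₀, M₀, Xb, K, ht, hT, hBw0, hBw, hden₀, hR, hXb, hK0, hK, hfinal⟩ := H
  obtain ⟨i₀, hi₀B, hi₀⟩ := h.toI.nonzero
  have hP0 : (0 : ℝ) ≤ P := by
    have := h.toI.bound i₀ hi₀B; exact_mod_cast (abs_nonneg _).trans this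
  refine h.kstep ht hT hBw0 (fun i hi => hBw i (hBU hi)) hΛ den₀ hden₀ M₀ (fun x τ i hi => hR x τ i (hBU hi))
    (fun i hi k => hXb (v i) (h.toI.abs_le i hi) k) K hK0 (fun x τ => le_trans ?_ (hK x τ)) hfinal
  have hM0 : (0 : ℝ) ≤ M₀ x τ := by
    obtain ⟨z₀, _, hz₀⟩ := hR x τ i₀ (hBU hi₀B); exact_mod_cast (abs_nonneg _).trans hz₀
  have hXb0 : (0 : ℝ) ≤ Xb := by
    have := hXb 0 (fun j => by simp) S.j₀; exact_mod_cast (abs_nonneg _).trans this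
  have hfac : 0 ≤ (M₀ x τ : ℝ) * (Xb : ℝ) ^ (∑ k, τ.2 k) * ((F.Dm Bv x : ℝ)) ^ 2 := by positivity
  exact mul_le_mul_of_nonneg_right (LvInvI.card_mul_le_of_subset hBU hP0) hfac

/-- **First k-step of a level from the uniform package.** [cite: Nesterenko2003, §4.2] -/
theorem kstep_odd_of_hypU (hBU : B ⊆ U) (h : S.LvInvSatI F R B v sgn pv lo L vlo Bv P m {x : ℤ | Odd x ∧ |x| ≤ (2 * N - 1 : ℤ)} T)
    (hΛ : ‖S.Λ / (S.b S.j₀ : ℚ_[p])‖ ≤ (p : ℝ)⁻¹) (H : S.KStepOddHypSatU F R U L Bv P m N N' T T') :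
    S.LvInvSatI F R B v sgn pv lo L vlo Bv P m {x : ℤ | |x| ≤ (N' : ℤ)} T' := by
  obtain ⟨t, Bw, den₀, M₀, Xb, K, ht, hT, hBw0, hBw, hden₀, hR, hXb, hK0, hK, hfinal⟩ := H
  obtain ⟨i₀, hi₀B, hi₀⟩ := h.toI.nonzero
  have hP0 : (0 : ℝ) ≤ P := by
    have := h.toI.bound i₀ hi₀B; exact_mod_cast (abs_nonneg _).trans this
  refine h.kstep_odd ht hT hBw0 (fun i hi => hBw i (hBU hi)) hΛ den₀ hden₀ M₀ (fun x τ i hi => hR x τ i (hBU hi))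
    (fun i hi k => hXb (v i) (h.toI.abs_le i hi) k) K hK0 (fun x τ => le_trans ?_ (hK x τ)) hfinal
  have hM0 : (0 : ℝ) ≤ M₀ x τ := by
    obtain ⟨z₀, _, hz₀⟩ := hR x τ i₀ (hBU hi₀B); exact_mod_cast (abs_nonneg _).trans hz₀
  have hXb0 : (0 : ℝ) ≤ Xb := by
    have := hXb 0 (fun j => by simp) S.j₀; exact_mod_cast (abs_nonneg _).trans this
  have hfac : 0 ≤ (M₀ x τ : ℝ) * (Xb : ℝ) ^ (∑ k, τ.2 k) * ((F.Dm Bv x : ℝ)) ^ 2 := by positivity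
  exact mul_le_mul_of_nonneg_right (LvInvI.card_mul_le_of_subset hBU hP0) hfac

/-- **`k` consecutive k-steps at one level of the saturated frame.** [cite: Nesterenko2003, §4.2] -/
theorem kchain (hBU : B ⊆ U) (hΛ : ‖S.Λ / (S.b S.j₀ : ℚ_[p])‖ ≤ (p : ℝ)⁻¹) (Nf Tf : ℕ → ℕ) (ν₀ : ℕ) :
    ∀ k : ℕ, (∀ ν, ν₀ ≤ ν → ν < ν₀ + k → S.KStepHypSatU F R U L Bv P m (Nf ν) (Nf (ν + 1)) (Tf ν) (Tf (ν + 1))) →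
      S.LvInvSatI F R B v sgn pv lo L vlo Bv P m {x : ℤ | |x| ≤ (Nf ν₀ : ℤ)} (Tf ν₀) →
      S.LvInvSatI F R B v sgn pv lo L vlo Bv P m {x : ℤ | |x| ≤ (Nf (ν₀ + k) : ℤ)} (Tf (ν₀ + k)) := by
  intro k
  induction k with
  | zero => intro _ h; simpa using h
  | succ k ih =>
    intro hyp h
    have h1 := ih (fun ν h0 h1 => hyp ν h0 (by omega)) h
    have h2 := kstep_of_hypU hBU h1 hΛ (hyp (ν₀ + k) (by omega) (by omega))
    rwa [show ν₀ + (k + 1) = ν₀ + k + 1 by omega]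

end LvInvSatI

end G3Setup

end Summit.ABC.StewartYu

end
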